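import Summits.QuantumFields.YangMills.Theorems.BalabanUVNodesN05SubBP2DK2PerKappaSlotExistsOfBindersLettersPerL
import Summits.QuantumFields.YangMills.Theorems.BalabanUVNodesN05SubBP2DK2PerKappaSlotExistsOfBindersLettersPerDoor
import Literature.MathematicalPhysics.QuantumFieldTheory.Balaban1983to89.B8Prop6PrintedZdCubPGamma

/-!
# BalabanUVNodes ∕ N05 ([Balaban1985RegularSpaces] Lemma 1 p. 79 – Thm 8 p. 101, Prop. 5 p. 94, Prop. 6 p. 99, (1.3)–(1.5) p. 77, p. 77 «Ω_j ⊂ T_η»;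
# [Balaban1985BackgroundPropagators] Thm 3.1 p. 397, Thm 3.3 p. 399, Thm 3.11 p. 416): (13)′ζ EDITION «L» — THE N05 WITNESS SLOT OF RECORD Slot8κ′ WITH THE K1⁹ DOOR RECIPE
# EXECUTED N05-SIDE, the [4] existence letters displayed IN PRINT's SMALL-FIELD CLASS `α₀ ≤ c_L` ONLY: dag-n05-d's (13)′ε-L `exists_residB8_slot8κ'_of_bindersPerAll_lettersPerL_at`
# (p672921) ∘ dag-n05-e's PROVED Proposition 6 ∘ every free scalar CHOSEN — link (L4) of the WATCH-HLET-THRESHOLD cure (ref-A g36; director-ym №235 (c)) —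
# displayed: NODE N06's five analytic binders and [4]'s two periodic letter families ONLY (WORK-SPLIT-2 dag-n05-c ∕ dag-n05-d; dag-n24-c SCOPE NOTE; director-ym №227 (b))

Track A of `YM-PLAN.md` (cell `pub-ymgap`, HUMAN RULING D-0062), node **N05**; seat `pub-ymgap-dag-n05-c` (g18), 2026-08-28; bears on K1⁹ `stmt-QuantumFields-27364`
(`--supports … --as helper`, count-neutral).  EDITION «L» of `BalabanUVNodesN05SubBP2DK2PerKappaSlotExistsOfBindersLettersPerDoor` (ζ, p670259): the SAME two theorems over
dag-n05-d's (13)′ε-L (p672921) instead of (13)′ε (p669550) — the displayed existence letters `hLet` carry the antecedent `α₀ ≤ cL →` (print's regime,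
[4] Thm 3.1 p. 397 «for U ∈ 𝔄_k(Ω, α₀), 0 < α₀ ≤ α₁») and `(hcL : 0 < cL)` is displayed; the door arithmetic `door_arith` is ζ's, BY NAME.  Cure chain of referee ref-A g36's
WATCH-HLET-THRESHOLD (pub-ymgap INBOX I.43225; dag-n05-d ACK I.43231; director-ym №235 (c)): (L1) `B8Prop5NestedServerSrcPerL` p672015 → (L2)
`…N05SubBP2DK2PerP5FrameSocketsServedL` p672148 → (L3) `…OfBindersLettersPerL` p672921 → (L4) THIS FILE.

[Balaban1985RegularSpaces] = T. Bałaban, *Spaces of regular gauge field configurations on a lattice and gauge fixing conditions*, CMP **99** (1985) 75–102: Lemma 1 p. 79,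
Thm 2 p. 83, Prop. 3 p. 87, Thm 4 p. 88 («there exists a constant c₁»), Prop. 5 (1.107)–(1.109) p. 94 («positive constants c₂, c₃, depending on d and L only»),
Prop. 6 (1.134)–(1.138) p. 99, Prop. 7 p. 100, Thm 8 (1.146) p. 101, (1.3)–(1.6) p. 77 («Ω_j ⊂ T_η»), §3 p. 98.  [Balaban1985BackgroundPropagators] Thm 3.1 p. 397,
Thm 3.3 p. 399, (3.40) p. 397, (3.42)–(3.47) p. 398, Thm 3.11 p. 416.

WHAT (by-name composition + real arithmetic on constants; no estimate, no definition).  (13)′ε-L (dag-n05-d g15, p672921; = ε p669550 with `hLet` thresholded) states the witness slot of record at a period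
`P` on: N06's record data and binder constants, the layer's primitive constants `B₀, B₀′, B₀β` (two PINNED to N06's expressions), [4]'s letter constants with the
free-constant relation `hfree`, Proposition 6 in dag-n05-e's served shape (`ρ₀, B₁⋆, c₁⋆, hP6`), Theorem 8's constants `γ₈, γ′, γ″, γβ, B₈, B₈β` (three PINNED) with the
(8′)∕(9′) inequalities `hB hB₀8 hγB hγB″ hB8β hB₁big` and the sourced server's `hfreeS`, then N06's five binders and the two letter families.  THIS FILE executes the
K1⁹ door recipe of (10)′ ((10)′ A's docstring; plan YMPLAN-G87-N05-10PRIME-2) ONCE, N05-side: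
* Proposition 6 := dag-n05-e's PROVED `B8Prop6PrintedZdCubPGamma.prop6Printed_zdCubP_γ_holds_record_dvd θ hD hL5 (t := 1)` (print-class cubes; needs `5 ≤ θ.L`, which
  the door's `θZ₃` carries);
* the five pins by `rfl` at `γ₈ := 1`; `B₀′ := 6·(2dL²)·B_G·B_R + 1` (⇒ `hfree`; ⇒ `hfreeS` since `B₈ ≥ B₀ ≥ 1`); `B₈ := B₀ + γ′B₀ + B₁⋆` (⇒ `hB₀8`, `hγB = hγB″`
  by `5dL ≥ 2`, `hB₁big` by `5dL(1+11d²) ≥ 1`); `B₈β := B₀β + 2B₀β(γ′B₀) + γβ` (⇒ `hB8β` by `5dL ≥ 1`); `hB : 2 ≤ 5dLB₀` from `B₀ ≥ 1`, `d, L ≥ 2` — the scalar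
  lemma `door_arith` below (`nlinarith` on the displayed signs).
WHAT IS PROVED (no estimate; no new definition):
* ★★★ `exists_residB8_slot8κ'_of_bindersLettersPer_doorL_at` — at a given period `P`: ε-L's conclusion `∃ lam c₁ ρ₀ ax, 0 < c₁ ∧ 1 ≤ ρ₀ ∧ B8LeafOfRecordSubBP₂DPerκ θ P Mκ Rκ ⟨…⟩`
  from: `hD : 2 ≤ θ.D`, `hL5 : 5 ≤ θ.L`, `[FiniteDimensional ℝ θ.𝔸]`, `(Mκ Rκ P)`, N06's record data `(τ, hτp, hτt, hτs, C_τ, hC_τ, ops₀, M ≥ 1)`, N06's binder constants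
  `a_I a_T a_S B₀ᴺ C_β c_S c_Sβ` with their signs, the Hölder pair `β len`, [4]'s letter constants `B₀′ᴴ B₂′ B_G B_R c_L` with their signs (`0 < c_L`), N06's five analytic
  binders `hinv hglob hhol hsrc hsrcH` ∀ (member, truncation `m ≤ k`), the existence letters `hLet` IN THE SMALL-FIELD CLASS `α₀ ≤ c_L`, the uniqueness letters `SLetUB` (already at
  `α₀ ≤ c_L`) — NOTHING ELSE (ε-L's texts VERBATIM).
* ★★★ `exists_residB8_slot8κ'_of_bindersLettersPer_doorL` — the same at the period `P := Mκ·θ.L`, `1 ≤ Mκ`, in dag-n24-c's (R3′) ∃-shape `∃ lam8 P c₁ ρ₀ ax, (0 < P ∧ Mκ·θ.L ∣ P) ∧ …`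
  ((10)′ part B's conclusion shape; the κ-index inhabitation guard `θ.L ≤ Rκ·Mκ` stays the door's: `nonempty_idxB8SubDPerκ_slot8κ'`).
DOOR (dag-n24-c): the K1-face junction's edition L is ONE `exact exists_residB8_slot8κ'_of_bindersLettersPer_doorL …` (ζ's argument list; only `hLet`'s TYPE changed).
HONEST FRAMING: composition BY NAME; 0 estimates of Bałaban's proved here; N06's five analytic binders and [4]'s two periodic letter families remain HYPOTHESES (NODE N06's
content — its object layer inhabits the binders at `torusIdx` only so far; the letters at nested periodic `Ω_j` are not yet served); count-neutral; **N05 NOT discharged**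
(director-ym №227 (b): only when every consumed socket is served by name); FLAG №4 OPEN; K1⁹ NOT claimed; Bałaban AS PRINTED (Thm 8 SURVIVING form); one finite 𝕋⁴ programme at
fixed ε; nothing continuum ∕ ℝ⁴ ∕ OS ∕ mass-gap ∕ Clay.  No `sorry`, no new definition.  Unit `pub-ymgap-dag-n05-c` (g18).
[cite: Balaban1985RegularSpaces, Lemma 1 p.79, Thm 2 p.83, Prop. 3 p.87, Thm 4 p.88, Prop. 5 (1.107)–(1.109) p.94, Prop. 6 (1.134)–(1.138) p.99, Prop. 7 p.100, Thm 8 (1.146) p.101, (1.3)–(1.6) p.77, p.77 («Ω_j ⊂ T_η»), §3 p.98; Balaban1985BackgroundPropagators, Thm 3.1 p.397, Thm 3.3 p.399, (3.40) p.397, (3.42)–(3.47) p.398, Thm 3.11 p.416]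
-/

noncomputable section

namespace Summit.QuantumFields.YangMills.BalabanUVNodes.N05SubBP2DK2PerKappaSlotExistsOfBindersLettersPerDoorL

open Literature.MathematicalPhysics.QuantumFieldTheory.Balaban1983to89
open Literature.MathematicalPhysics.QuantumFieldTheory.Balaban1983to89.Node00
open Literature.MathematicalPhysics.QuantumFieldTheory.Balaban1983to89.B8IdxB8LawsB (IdxB8LawsB IdxB8SubB)
open Literature.MathematicalPhysics.QuantumFieldTheory.Balaban1983to89.B8LeafModelZd (ZdIdx)
open Literature.MathematicalPhysics.QuantumFieldTheory.Balaban1983to89.B8LeafModelZdHP2Per (zdGF3HP₂Per)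
open Literature.MathematicalPhysics.QuantumFieldTheory.Balaban1983to89.B8TowerBondsPrinted (towerBondsP)
open Literature.MathematicalPhysics.QuantumFieldTheory.Balaban1983to89.B8Lemma1NonAbelian (mulCfg)
open Literature.MathematicalPhysics.QuantumFieldTheory.Balaban1983to89.B8LanF146 (LanF146)
open Literature.MathematicalPhysics.QuantumFieldTheory.Balaban1983to89.B8Prop5LandauDataZdPer (zdLanPer)
open Literature.MathematicalPhysics.QuantumFieldTheory.Balaban1983to89.B8Prop5LandauDataZd (ZdLanIdx)
open Literature.MathematicalPhysics.QuantumFieldTheory.Balaban1983to89.B8LeafModelZd3SockH2Per (SockB9P3H2Per)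
open Literature.MathematicalPhysics.QuantumFieldTheory.Balaban1983to89.B9SupplySockB9P3ZdSrcPer (SrcAtIPer SrcHolderAtIH2Per)
open Literature.MathematicalPhysics.QuantumFieldTheory.Balaban1983to89.B9SupplySockB9P3ZdLetters (OpsZd)
open Literature.MathematicalPhysics.QuantumFieldTheory.Balaban1983to89.B9Eq327GreenZdHermPer (InvAtHIPer)
open Literature.MathematicalPhysics.QuantumFieldTheory.Balaban1983to89.B9SupplySockB9P3ZdPer (GlobAtIPer)
open Literature.MathematicalPhysics.QuantumFieldTheory.Balaban1983to89.B9SupplySockB9P3ZdH2Per (HolderAtIH2Per)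
open Literature.MathematicalPhysics.QuantumFieldTheory.Balaban1983to89.B9SupplySockB9P3ZdAllLettersZdPer (opsAllZdPer)
open Literature.MathematicalPhysics.QuantumFieldTheory.Balaban1983to89.B9Eq316AveragingTransposeZd (betaTau qQ)
open Summit.QuantumFields.YangMills.BalabanUVNodes.N05SubBP2DK2PerKappaSlotExistsOfBindersPerAllP5Letters (exists_residB8_slot8κ'_of_bindersPerAll_p5Letters_at)
open Summit.QuantumFields.YangMills.BalabanUVNodes.N05SubBP2DK2PerP5FrameSocketsServed (sp5base_idxB8SubDPerκ_served sp5_idxB8SubDPerκ_served)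
open Literature.MathematicalPhysics.QuantumFieldTheory.Balaban1983to89.B9SupplySockH59ZdSrcPer (sockH59srcPer_opsAllZdPer_towerBondsP)
open Literature.MathematicalPhysics.QuantumFieldTheory.Balaban1983to89.B9Eq316AveragingTransposeZdLevelZero (LevelSepPP0 levelSepPP0_of_levelSepPP)
open Literature.MathematicalPhysics.QuantumFieldTheory.Balaban1983to89.B8TowerBondsLayerLawSubD (IdxB8SubD.levelSepPP_towerBondsP)
open T4TermwiseTorus (IsPeriodic)
open MatrixLog B7Prop1Explicit B7Prop2Explicit B7Prop1Local B7Eq92Concrete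
open B8Ineq130 (tlo thi)
open B8Ineq132 (InAk covDerivFwd)
open B8Eq119TwistedAxial (Restr129 InAx bgT)
open B8Eq140Level (SideTouches)
open B8Eq138LandauZd (covLap covDivB QT logCfg InR138 IsLandau146W)
open B8Eq184Proof (gaugeExp cfgExp)
open B8Eq146AExpansion (iEta plaqCovDeriv)
open B8Eq143PlaqExpansion (pdiv)
open B7Prop4GeneralLevels (linCovIter)
open B8Eq155JBound (Jcur wsup)
open B8ScaledSupNorm (bondNorm msup Bdd)
open B9Eq340HolderZd (hquot AdmPair)
open B7Eq78Linearization (zdBlocking QprimeIter)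
open B8Eq1117Concrete (XSpace)
open B8Prop5ContractionKLevel (Bd2)
open B8LambdaSpaceKLevel (wt)
-- `Site` alone could resolve to the torus sites of `Setup.lean`; re-export the `ℤ^d` sites of `B7Prop1Explicit`.
export B7Prop1Explicit (Site)
open Summit.QuantumFields.YangMills.BalabanUVNodes.N05SubBP2DK2PerKappaSlotExistsOfBindersLettersPerL (exists_residB8_slot8κ'_of_bindersPerAll_lettersPerL_at)
open Summit.QuantumFields.YangMills.BalabanUVNodes.N05SubBP2DK2PerKappaSlotExistsOfBindersLettersPerDoor (door_arith)
open Literature.MathematicalPhysics.QuantumFieldTheory.Balaban1983to89.B8Prop6PrintedZdCubPGamma (prop6Printed_zdCubP_γ_holds_record_dvd)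

/-! ## The witness slot of record on N06's binders and [4]'s small-field letters only -/

section Door

variable (θ : Stage3Params)

/-- ★★★ EDITION «L» — **THE N05 WITNESS SLOT OF RECORD AT A PERIOD `P`, ON NODE N06's BINDERS AND [4]'s LETTERS (SMALL-FIELD CLASS) ONLY** — (13)′ε-L with the K1⁹ door
recipe executed: Proposition 6 by dag-n05-e's proved `prop6Printed_zdCubP_γ_holds_record_dvd` (`5 ≤ θ.L`), the five pins by `rfl` at `γ₈ := 1`, `B₀′ ∕ B₈ ∕ B₈β` chosen and
the (8′)∕(9′)∕free-constant inequalities by ζ's `door_arith`; displayed (ε-L's texts VERBATIM): N06's record data and binder constants, the Hölder pair, [4]'s letter constants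
(`0 < c_L`), N06's five analytic binders ∀ (member, truncation), the existence letters `hLet` for `0 < α₀ ≤ c_L`, the uniqueness letters `SLetUB`.
[cite: Balaban1985RegularSpaces, Lemma 1 – Thm 8 pp.79–101, Prop. 5 p.94, Prop. 6 p.99, (1.3)–(1.5) p.77, p.77 («Ω_j ⊂ T_η»); Balaban1985BackgroundPropagators, Thm 3.1 p.397, Thm 3.3 p.399, Thm 3.11 p.416] -/
theorem exists_residB8_slot8κ'_of_bindersLettersPer_doorL_at (hD : 2 ≤ θ.D) (hL5 : 5 ≤ θ.L) [FiniteDimensional ℝ θ.𝔸] (Mκ Rκ P : ℕ)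
    -- NODE N06's GENUINE TORUS RECORD DATA: a faithful Hermitian tracial state `τ` with its Cauchy–Schwarz constant `C_τ`, the base letters `ops₀`, the block parameter `M ≥ 1`
    (τ : θ.𝔸 →ₗ[ℂ] ℂ) (hτp : ∀ a : θ.𝔸, a ≠ 0 → 0 < (τ (star a * a)).re) (hτt : ∀ a b : θ.𝔸, τ (a * b) = τ (b * a))
    (hτs : ∀ a : θ.𝔸, τ (star a) = starRingEnd ℂ (τ a)) {Cτ : ℝ} (hCτ : ∀ x y : θ.𝔸, |(τ (star x * y)).re| ≤ Cτ * ‖x‖ * ‖y‖)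
    (ops₀ : ℝ → ZdIdx θ.D θ.L → ℕ → OpsZd θ.D θ.𝔸) {M : ℝ} (hM1 : 1 ≤ M)
    -- NODE N06's BINDER CONSTANTS ([4] Thm 3.11's `a_I`, (3.47)'s `a_T, B₀ᴺ`, (3.45)'s `C_β`, the source binders' `a_S, c_S, c_Sβ`) — OUTER
    {aI aT aS B₀N Cβ cS cSβ : ℝ} (haI : 0 < aI) (haT : 0 < aT) (haS : 0 < aS) (hB₀N : 0 < B₀N) (hCβ : 0 < Cβ) (hcS : 0 ≤ cS) (hcSβ : 0 ≤ cSβ)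
    -- the Hölder pair of the layer — OUTER (every other layer constant is CHOSEN inside: `B₀, B₀β, γ′, γ″, γβ` = N06's pinned expressions, `γ₈ := 1`,
    -- `B₀′ := 6·(2dL²)·B_G·B_R + 1`, `B₈ := B₀ + γ′B₀ + B₁⋆`, `B₈β := B₀β + 2B₀β(γ′B₀) + γβ`; Proposition 6's `ρ₀, B₁⋆, c₁⋆` by dag-n05-e's proved theorem)
    {β : ℝ} {len : Site θ.D → ℝ}
    -- [4]'s PROPOSITION-5 LETTER CONSTANTS ((1.92)'s `B₀′ᴴ, B₂′`, (1.101)'s `B_G`, (1.98)'s `B_R`), the regularity threshold `c_L > 0` — OUTER (the letters' own constants)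
    {B₀'H B₂' BG BR cL : ℝ} (hB₀'H : 0 < B₀'H) (hB₂' : 0 ≤ B₂') (hBG : 0 ≤ BG) (hBR : 0 ≤ BR) (hcL : 0 < cL)
    -- NODE N06's FIVE ANALYTIC BINDERS PER MEMBER AT EVERY TRUNCATION `m ≤ k`, at the genuine torus record with print's class (1.31) — HYPOTHESES ([4] Thm 3.11,
    -- (3.47)@−3, (3.45), (3.42)₃∕(3.43); dag-n06-b `B9SupplySockH59ZdSrcPer` §3's displayed inputs VERBATIM at `ι := toZdIdx`, `p := fun _ => P`; N06's object layer inhabits them)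
    (hinv : ∀ (a : IdxB8SubDPerκ θ P Mκ Rκ) (m : ℕ), m ≤ a.toZdIdx.k →
      InvAtHIPer P θ.L (opsAllZdPer τ θ.L P (fun k j => towerBondsP θ.L a.toZdIdx.Ω (a.toZdIdx.Λs k) j) ops₀) aI M a.toZdIdx m)
    (hglob : ∀ (a : IdxB8SubDPerκ θ P Mκ Rκ) (m : ℕ), m ≤ a.toZdIdx.k →
      GlobAtIPer P θ.L (opsAllZdPer τ θ.L P (fun k j => towerBondsP θ.L a.toZdIdx.Ω (a.toZdIdx.Λs k) j) ops₀) aT B₀N M a.toZdIdx m)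
    (hhol : ∀ (a : IdxB8SubDPerκ θ P Mκ Rκ) (m : ℕ), m ≤ a.toZdIdx.k →
      HolderAtIH2Per P θ.L (opsAllZdPer τ θ.L P (fun k j => towerBondsP θ.L a.toZdIdx.Ω (a.toZdIdx.Λs k) j) ops₀) aT Cβ β len M a.toZdIdx m)
    (hsrc : ∀ (a : IdxB8SubDPerκ θ P Mκ Rκ) (m : ℕ), m ≤ a.toZdIdx.k →
      SrcAtIPer P θ.L (opsAllZdPer τ θ.L P (fun k j => towerBondsP θ.L a.toZdIdx.Ω (a.toZdIdx.Λs k) j) ops₀) aS cS M a.toZdIdx m)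
    (hsrcH : ∀ (a : IdxB8SubDPerκ θ P Mκ Rκ) (m : ℕ), m ≤ a.toZdIdx.k →
      SrcHolderAtIH2Per P θ.L (opsAllZdPer τ θ.L P (fun k j => towerBondsP θ.L a.toZdIdx.Ω (a.toZdIdx.Λs k) j) ops₀) aS cSβ β len M a.toZdIdx m)
    -- [4]'s LETTERS AT PERIODIC ARGUMENTS — HYPOTHESES (NODE N06's periodic letters ∕ lit-balaban to serve; [Balaban1985BackgroundPropagators] Thm 3.1 p. 397, Thms 3.2–3.3):
    -- (E) the EXISTENCE letters at every print-class periodic member, every unitary `P`-periodic background in the SMALL-FIELD class `𝔄_k({Ω_j}, α₀)`,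
    -- `0 < α₀ ≤ c_L` ([4] Thm 3.1's regime), every truncation `1 ≤ n ≤ k` — `B8Prop5NestedServerSrcPerL`'s thresholded `hLet` text VERBATIM (= dag-n05-c's
    -- `…P5FrameSocketsServedL` displayed input; the currency-2 existence letters `SLet` are its truncation-`k` instance);
    -- (U) the UNIQUENESS letters at the periodic members of record `a : IdxB8LanCκPer θ P Mκ Rκ` — `B8Prop5UniqueZdLanPer`'s `SLetUBper` VERBATIM (as in (13)′β∕δ)
    (hLet : ∀ a : IdxB8SubDPerκ θ P Mκ Rκ, ∀ α₀ : ℝ, 0 < α₀ → α₀ ≤ cL → ∀ U₀ : Site θ.D → Fin θ.D → θ.𝔸ˣ, (∀ x κ, U₀ x κ ∈ unitaryUnits θ.𝔸) → IsPeriodic P U₀ →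
      InAk θ.L a.toZdIdx.k a.toZdIdx.η α₀ a.toZdIdx.Ω U₀ → ∀ n, 1 ≤ n → n ≤ a.toZdIdx.k →
      ∃ (g Δ : (Site θ.D → θ.𝔸) →ₗ[ℂ] (Site θ.D → θ.𝔸)) (q : (Site θ.D → θ.𝔸) →ₗ[ℂ] (ℕ → Site θ.D → θ.𝔸)) (qs : (ℕ → Site θ.D → θ.𝔸) →ₗ[ℂ] (Site θ.D → θ.𝔸))
        (Aw c : (ℕ → Site θ.D → θ.𝔸) →ₗ[ℂ] (ℕ → Site θ.D → θ.𝔸)) (H' : XSpace θ.D n θ.𝔸 →ₗ[ℂ] (Site θ.D → θ.𝔸)),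
        (∀ x, (∀ (z : Site θ.D) (i : Fin θ.D), x (z + (P : ℤ) • e i) = x z) → ∀ y ∈ a.toZdIdx.Ω 0, (Δ (g x) + qs (Aw (q (g x)))) y = x y) ∧
        (∀ f, (∀ (z : Site θ.D) (i : Fin θ.D), f (z + (P : ℤ) • e i) = f z) → q (g (g (qs (c (q f))))) = q f) ∧
        (∀ (f : Site θ.D → θ.𝔸) (z : Site θ.D) (i : Fin θ.D), g f (z + (P : ℤ) • e i) = g f z) ∧
        (∀ f : Site θ.D → θ.𝔸, (∀ (z : Site θ.D) (i : Fin θ.D), f (z + (P : ℤ) • e i) = f z) →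
      ∀ (z : Site θ.D) (i : Fin θ.D), qs (c (q f)) (z + (P : ℤ) • e i) = qs (c (q f)) z) ∧
        (∀ (f : Site θ.D → θ.𝔸), ∀ x ∈ a.toZdIdx.Ω 0, Δ f x = covLap a.toZdIdx.η U₀ ((a.toZdIdx.Ω 0).indicator f) x) ∧
        (∀ (μ : ℕ → Site θ.D → θ.𝔸), ∀ x ∈ a.toZdIdx.Ω 0, qs μ x = QT θ.L n (a.toZdIdx.Λs n) U₀ μ x) ∧
        (∀ (f : Site θ.D → θ.𝔸) (j : ℕ), j ≤ n → ∀ y ∈ a.toZdIdx.Λs n j, q f j y = QprimeIter (zdBlocking θ.D θ.L) (bgT θ.L U₀) j f y) ∧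
        (∀ (X : XSpace θ.D n θ.𝔸) (x : Site θ.D), ‖H' X x‖ ≤ B₀'H * ‖X‖) ∧
        (∀ j, j ≤ n → ∀ (X : XSpace θ.D n θ.𝔸), ∀ b ∈ {b : Site θ.D × Fin θ.D | SideTouches (a.toZdIdx.Ω j) b.1 b.2},
      wt θ.L a.toZdIdx.η j * ‖covDerivFwd a.toZdIdx.η U₀ b.2 (H' X) b.1‖ ≤ B₀'H * ‖X‖) ∧
        (∀ X : XSpace θ.D n θ.𝔸, Bd2 θ.L a.toZdIdx.η n a.toZdIdx.Ω (covLap a.toZdIdx.η U₀ (H' X)) (B₂' * ‖X‖)) ∧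
        (∀ (X : XSpace θ.D n θ.𝔸) (x : Site θ.D), x ∉ a.toZdIdx.Ω 0 → H' X x = 0) ∧
        (∀ X Y : XSpace θ.D n θ.𝔸, (∀ b, Y b = -star (X b)) → ∀ x, H' Y x = -star (H' X x)) ∧
        (∀ X : XSpace θ.D n θ.𝔸, (∀ (b : Fin (n + 1) × Site θ.D) (i : Fin θ.D), X (b.1, b.2 + ((P : ℤ) / (θ.L : ℤ) ^ (b.1 : ℕ)) • e i) = X b) →
      ∀ (z : Site θ.D) (i : Fin θ.D), H' X (z + (P : ℤ) • e i) = H' X z) ∧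
        (∀ (Y : XSpace θ.D n θ.𝔸), (∀ (b : Fin (n + 1) × Site θ.D) (i : Fin θ.D), Y (b.1, b.2 + ((P : ℤ) / (θ.L : ℤ) ^ (b.1 : ℕ)) • e i) = Y b) →
      ∀ (j : ℕ) (hj : j ≤ n) (y : Site θ.D), y ∈ a.toZdIdx.Λs n j →
      QprimeIter (zdBlocking θ.D θ.L) (bgT θ.L U₀) j (H' Y) y = Y (⟨j, Nat.lt_succ_of_le hj⟩, y)) ∧
        (∀ (f : Site θ.D → θ.𝔸) (r : ℝ), 0 ≤ r → Bd2 θ.L a.toZdIdx.η n a.toZdIdx.Ω f r →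
      (∀ x, ‖g f x‖ ≤ BG * r) ∧ ∀ j, j ≤ n → ∀ b ∈ {b : Site θ.D × Fin θ.D | SideTouches (a.toZdIdx.Ω j) b.1 b.2},
        wt θ.L a.toZdIdx.η j * ‖covDerivFwd a.toZdIdx.η U₀ b.2 (g f) b.1‖ ≤ BG * r) ∧
        (∀ (f : Site θ.D → θ.𝔸) (x : Site θ.D), x ∉ a.toZdIdx.Ω 0 → g f x = 0) ∧
        (∀ f : Site θ.D → θ.𝔸, (∀ j, j ≤ n → ∀ x ∈ a.toZdIdx.Ω j, IsSelfAdjoint (f x)) → ∀ x, IsSelfAdjoint (g f x)) ∧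
        (∀ (f : Site θ.D → θ.𝔸) (r : ℝ), 0 ≤ r → Bd2 θ.L a.toZdIdx.η n a.toZdIdx.Ω f r → Bd2 θ.L a.toZdIdx.η n a.toZdIdx.Ω (f - g (qs (c (q (g f))))) (BR * r)) ∧
        (∀ f : Site θ.D → θ.𝔸, (∀ j, j ≤ n → ∀ x ∈ a.toZdIdx.Ω j, IsSelfAdjoint (f x)) →
      ∀ j, j ≤ n → ∀ x ∈ a.toZdIdx.Ω j, IsSelfAdjoint ((f - g (qs (c (q (g f))))) x)))
    (SLetUB : ∀ a : IdxB8LanCκPer θ P Mκ Rκ, ∀ α₀ : ℝ, 0 < α₀ → α₀ ≤ cL → InAk θ.L a.toZdLanIdx.k a.toZdLanIdx.η α₀ a.toZdLanIdx.Ω a.toZdLanIdx.U₀ →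
      ∃ (g Δ : (Site θ.D → θ.𝔸) →ₗ[ℂ] (Site θ.D → θ.𝔸)) (q : (Site θ.D → θ.𝔸) →ₗ[ℂ] (ℕ → Site θ.D → θ.𝔸)) (qs : (ℕ → Site θ.D → θ.𝔸) →ₗ[ℂ] (Site θ.D → θ.𝔸))
        (Aw c : (ℕ → Site θ.D → θ.𝔸) →ₗ[ℂ] (ℕ → Site θ.D → θ.𝔸)) (H' : XSpace θ.D a.toZdLanIdx.k θ.𝔸 →ₗ[ℂ] (Site θ.D → θ.𝔸)),
        (∀ x : Site θ.D → θ.𝔸, (∀ (z : Site θ.D) (i : Fin θ.D), x (z + (P : ℤ) • e i) = x z) → (∃ C : ℝ, ∀ y, ‖x y‖ ≤ C) →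
          g (Δ x + qs (Aw (q x))) = x) ∧
        (∀ φ : ℕ → Site θ.D → θ.𝔸, (∀ n, n ≤ a.toZdLanIdx.k → ∀ (y : Site θ.D) (i : Fin θ.D), φ n (y + ((P : ℤ) / (θ.L : ℤ) ^ n) • e i) = φ n y) →
          qs (c (q (g (g (qs φ))))) = qs φ) ∧
        (∀ (f : Site θ.D → θ.𝔸), ∀ x ∈ a.toZdLanIdx.Ω 0, Δ f x = covLap a.toZdLanIdx.η a.toZdLanIdx.U₀ ((a.toZdLanIdx.Ω 0).indicator f) x) ∧
        (∀ (μ : ℕ → Site θ.D → θ.𝔸), ∀ x ∈ a.toZdLanIdx.Ω 0, qs μ x = QT θ.L a.toZdLanIdx.k a.toZdLanIdx.Λ a.toZdLanIdx.U₀ μ x) ∧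
        (∀ (f : Site θ.D → θ.𝔸) (n : ℕ), n ≤ a.toZdLanIdx.k → ∀ y ∈ a.toZdLanIdx.Λ n, q f n y = QprimeIter (zdBlocking θ.D θ.L) (bgT θ.L a.toZdLanIdx.U₀) n f y) ∧
        (∀ (f : Site θ.D → θ.𝔸) (n : ℕ) (y : Site θ.D), ¬ (n ≤ a.toZdLanIdx.k ∧ y ∈ a.toZdLanIdx.Λ n) → q f n y = 0) ∧
        (∀ (f : Site θ.D → θ.𝔸) (z : Site θ.D) (i : Fin θ.D), g f (z + (P : ℤ) • e i) = g f z) ∧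
        (∀ μ : ℕ → Site θ.D → θ.𝔸, ∀ n, n ≤ a.toZdLanIdx.k → ∀ (y : Site θ.D) (i : Fin θ.D), Aw μ n (y + ((P : ℤ) / (θ.L : ℤ) ^ n) • e i) = Aw μ n y) ∧
        (∀ (X : XSpace θ.D a.toZdLanIdx.k θ.𝔸) (x : Site θ.D), ‖H' X x‖ ≤ B₀'H * ‖X‖) ∧
        (∀ n, n ≤ a.toZdLanIdx.k → ∀ (X : XSpace θ.D a.toZdLanIdx.k θ.𝔸), ∀ b ∈ {b : Site θ.D × Fin θ.D | SideTouches (a.toZdLanIdx.Ω n) b.1 b.2},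
          wt θ.L a.toZdLanIdx.η n * ‖covDerivFwd a.toZdLanIdx.η a.toZdLanIdx.U₀ b.2 (H' X) b.1‖ ≤ B₀'H * ‖X‖) ∧
        (∀ X : XSpace θ.D a.toZdLanIdx.k θ.𝔸, Bd2 θ.L a.toZdLanIdx.η a.toZdLanIdx.k a.toZdLanIdx.Ω (covLap a.toZdLanIdx.η a.toZdLanIdx.U₀ (H' X)) (B₂' * ‖X‖)) ∧
        (∀ X : XSpace θ.D a.toZdLanIdx.k θ.𝔸, (∀ (q : Fin (a.toZdLanIdx.k + 1) × Site θ.D) (i : Fin θ.D), X (q.1, q.2 + ((P : ℤ) / (θ.L : ℤ) ^ (q.1 : ℕ)) • e i) = X q) →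
          ∀ (z : Site θ.D) (i : Fin θ.D), H' X (z + (P : ℤ) • e i) = H' X z) ∧
        (∀ (Y : XSpace θ.D a.toZdLanIdx.k θ.𝔸), (∀ (q : Fin (a.toZdLanIdx.k + 1) × Site θ.D) (i : Fin θ.D), Y (q.1, q.2 + ((P : ℤ) / (θ.L : ℤ) ^ (q.1 : ℕ)) • e i) = Y q) →
          ∀ (n : ℕ) (hn : n ≤ a.toZdLanIdx.k) (y : Site θ.D), y ∈ a.toZdLanIdx.Λ n →
          QprimeIter (zdBlocking θ.D θ.L) (bgT θ.L a.toZdLanIdx.U₀) n (H' Y) y = Y (⟨n, Nat.lt_succ_of_le hn⟩, y)) ∧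
        (∀ (f : Site θ.D → θ.𝔸) (r : ℝ), 0 ≤ r → Bd2 θ.L a.toZdLanIdx.η a.toZdLanIdx.k a.toZdLanIdx.Ω f r →
          (∀ x, ‖g f x‖ ≤ BG * r) ∧ ∀ n, n ≤ a.toZdLanIdx.k → ∀ b ∈ {b : Site θ.D × Fin θ.D | SideTouches (a.toZdLanIdx.Ω n) b.1 b.2},
            wt θ.L a.toZdLanIdx.η n * ‖covDerivFwd a.toZdLanIdx.η a.toZdLanIdx.U₀ b.2 (g f) b.1‖ ≤ BG * r) ∧
        (∀ (f : Site θ.D → θ.𝔸) (r : ℝ), 0 ≤ r → Bd2 θ.L a.toZdLanIdx.η a.toZdLanIdx.k a.toZdLanIdx.Ω f r →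
          Bd2 θ.L a.toZdLanIdx.η a.toZdLanIdx.k a.toZdLanIdx.Ω (f - g (qs (c (q (g f))))) (BR * r))) :
    ∃ (lam : ResidB8 θ) (c₁ : ℝ) (ρ₀' : ℕ)
      (ax : ∀ j : IdxB8SubDPer θ P, (famB8OfRecordPer θ (lam.cutSubBP₅κPer P Mκ Rκ c₁ ρ₀').β (lam.cutSubBP₅κPer P Mκ Rκ c₁ ρ₀').len P j).Cfg →
        (famB8OfRecordPer θ (lam.cutSubBP₅κPer P Mκ Rκ c₁ ρ₀').β (lam.cutSubBP₅κPer P Mκ Rκ c₁ ρ₀').len P j).Pert →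
        (famB8OfRecordPer θ (lam.cutSubBP₅κPer P Mκ Rκ c₁ ρ₀').β (lam.cutSubBP₅κPer P Mκ Rκ c₁ ρ₀').len P j).Pert),
      0 < c₁ ∧ 1 ≤ ρ₀' ∧ B8LeafOfRecordSubBP₂DPerκ θ P Mκ Rκ ⟨lam.cutSubBP₅κPer P Mκ Rκ c₁ ρ₀', ax⟩ := by
  -- PROPOSITION 6 at print-class cubes, PROVED class-wide (dag-n05-e), `t := 1`
  obtain ⟨ρ₀, B₁s, c₁s, hρ₀, -, hB₁s, hc₁s, hP6⟩ := prop6Printed_zdCubP_γ_holds_record_dvd θ hD hL5 (t := 1) le_rfl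
  -- N06's pinned constants at `γ₈ := 1`
  obtain ⟨B₀, hB₀eq⟩ : ∃ B₀ : ℝ, B₀ = max 1 (2 * B₀N * max 1 (qQ θ.D θ.L Cτ (betaTau τ) 1)) := ⟨_, rfl⟩
  obtain ⟨B₀β, hB₀βeq⟩ : ∃ B₀β : ℝ, B₀β = 2 * max 0 Cβ * max 1 (qQ θ.D θ.L Cτ (betaTau τ) 1) := ⟨_, rfl⟩
  obtain ⟨γ', hγ'eq⟩ : ∃ γ' : ℝ, γ' = 2 * cS * (1 : ℝ) / max 1 (2 * B₀N * max 1 (qQ θ.D θ.L Cτ (betaTau τ) 1)) := ⟨_, rfl⟩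
  obtain ⟨γβ, hγβeq⟩ : ∃ γβ : ℝ, γβ = (max 0 Cβ * cS / B₀N + cSβ) * (1 : ℝ) := ⟨_, rfl⟩
  have hB₀1 : 1 ≤ B₀ := by rw [hB₀eq]; exact le_max_left _ _
  have hγ'0 : 0 ≤ γ' := by
    rw [hγ'eq]; exact div_nonneg (by positivity) (le_trans zero_le_one (le_max_left _ _))
  have hB₀β0 : 0 ≤ B₀β := by rw [hB₀βeq]; positivity
  have hγβ0 : 0 ≤ γβ := by rw [hγβeq]; positivity
  -- the door's free scalars and their inequalities
  obtain ⟨B₈, hB₈eq⟩ : ∃ B₈ : ℝ, B₈ = B₀ + γ' * B₀ + B₁s := ⟨_, rfl⟩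
  obtain ⟨B₈β, hB₈βeq⟩ : ∃ B₈β : ℝ, B₈β = B₀β + 2 * B₀β * (γ' * B₀) + γβ := ⟨_, rfl⟩
  obtain ⟨B₀', hB₀'eq⟩ : ∃ B₀' : ℝ, B₀' = 6 * (2 * (θ.D : ℝ) * (θ.L : ℝ) ^ 2) * BG * BR + 1 := ⟨_, rfl⟩
  obtain ⟨hB₀', hB, hB₀8, hγB, hB8β, hB₁big, hfree, hfreeS⟩ :=
    door_arith θ.D θ.L hD θ.two_le_L hB₀1 hγ'0 hB₀β0 hγβ0 hB₁s hBG hBR hB₈eq hB₈βeq hB₀'eq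
  exact exists_residB8_slot8κ'_of_bindersPerAll_lettersPerL_at θ hD Mκ Rκ P τ hτp hτt hτs hCτ ops₀ hM1 haI haT haS hB₀N hCβ hcS hcSβ hB₀' hB₀eq hB₀βeq hB₀'H hB₂' hBG hBR hcL hfree hρ₀ hc₁s hP6 (le_refl (1 : ℝ)) hγ'eq hγ'eq hγβeq hB hB₀8 hγB hγB hB8β hB₁big hfreeS hinv hglob hhol hsrc hsrcH hLet SLetUB

/-- ★★★ EDITION «L» — **THE Slot8κ′ λ-TERM's ∃-BODY ON NODE N06's BINDERS AND [4]'s LETTERS (SMALL-FIELD CLASS) ONLY** (dag-n24-c (R3′) shape; (10)′ part B's conclusion):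
the theorem above at the period `P := Mκ·θ.L`, `1 ≤ Mκ` (the κ-index inhabitation guard `θ.L ≤ Rκ·Mκ` is the door's: (10)′ A's `nonempty_idxB8SubDPerκ_slot8κ'`).
[cite: Balaban1985RegularSpaces, Lemma 1 – Thm 8 pp.79–101, Prop. 5 p.94, (1.3)–(1.4) p.77, p.77 («Ω_j ⊂ T_η»); Balaban1985BackgroundPropagators, Thm 3.1 p.397, Thm 3.3 p.399] -/
theorem exists_residB8_slot8κ'_of_bindersLettersPer_doorL (hD : 2 ≤ θ.D) (hL5 : 5 ≤ θ.L) [FiniteDimensional ℝ θ.𝔸] (Mκ Rκ : ℕ) (hM₁ : 1 ≤ Mκ)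
    -- NODE N06's GENUINE TORUS RECORD DATA: a faithful Hermitian tracial state `τ` with its Cauchy–Schwarz constant `C_τ`, the base letters `ops₀`, the block parameter `M ≥ 1`
    (τ : θ.𝔸 →ₗ[ℂ] ℂ) (hτp : ∀ a : θ.𝔸, a ≠ 0 → 0 < (τ (star a * a)).re) (hτt : ∀ a b : θ.𝔸, τ (a * b) = τ (b * a))
    (hτs : ∀ a : θ.𝔸, τ (star a) = starRingEnd ℂ (τ a)) {Cτ : ℝ} (hCτ : ∀ x y : θ.𝔸, |(τ (star x * y)).re| ≤ Cτ * ‖x‖ * ‖y‖)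
    (ops₀ : ℝ → ZdIdx θ.D θ.L → ℕ → OpsZd θ.D θ.𝔸) {M : ℝ} (hM1 : 1 ≤ M)
    -- NODE N06's BINDER CONSTANTS ([4] Thm 3.11's `a_I`, (3.47)'s `a_T, B₀ᴺ`, (3.45)'s `C_β`, the source binders' `a_S, c_S, c_Sβ`) — OUTER
    {aI aT aS B₀N Cβ cS cSβ : ℝ} (haI : 0 < aI) (haT : 0 < aT) (haS : 0 < aS) (hB₀N : 0 < B₀N) (hCβ : 0 < Cβ) (hcS : 0 ≤ cS) (hcSβ : 0 ≤ cSβ)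
    -- the Hölder pair of the layer — OUTER (every other layer constant is CHOSEN inside: `B₀, B₀β, γ′, γ″, γβ` = N06's pinned expressions, `γ₈ := 1`,
    -- `B₀′ := 6·(2dL²)·B_G·B_R + 1`, `B₈ := B₀ + γ′B₀ + B₁⋆`, `B₈β := B₀β + 2B₀β(γ′B₀) + γβ`; Proposition 6's `ρ₀, B₁⋆, c₁⋆` by dag-n05-e's proved theorem)
    {β : ℝ} {len : Site θ.D → ℝ}
    -- [4]'s PROPOSITION-5 LETTER CONSTANTS ((1.92)'s `B₀′ᴴ, B₂′`, (1.101)'s `B_G`, (1.98)'s `B_R`), the regularity threshold `c_L > 0` — OUTER (the letters' own constants)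
    {B₀'H B₂' BG BR cL : ℝ} (hB₀'H : 0 < B₀'H) (hB₂' : 0 ≤ B₂') (hBG : 0 ≤ BG) (hBR : 0 ≤ BR) (hcL : 0 < cL)
    -- NODE N06's FIVE ANALYTIC BINDERS PER MEMBER AT EVERY TRUNCATION `m ≤ k`, at the genuine torus record with print's class (1.31) — HYPOTHESES ([4] Thm 3.11,
    -- (3.47)@−3, (3.45), (3.42)₃∕(3.43); dag-n06-b `B9SupplySockH59ZdSrcPer` §3's displayed inputs VERBATIM at `ι := toZdIdx`, `p := fun _ => P`; N06's object layer inhabits them)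
    (hinv : ∀ (a : IdxB8SubDPerκ θ (Mκ * θ.L) Mκ Rκ) (m : ℕ), m ≤ a.toZdIdx.k →
      InvAtHIPer (Mκ * θ.L) θ.L (opsAllZdPer τ θ.L (Mκ * θ.L) (fun k j => towerBondsP θ.L a.toZdIdx.Ω (a.toZdIdx.Λs k) j) ops₀) aI M a.toZdIdx m)
    (hglob : ∀ (a : IdxB8SubDPerκ θ (Mκ * θ.L) Mκ Rκ) (m : ℕ), m ≤ a.toZdIdx.k →
      GlobAtIPer (Mκ * θ.L) θ.L (opsAllZdPer τ θ.L (Mκ * θ.L) (fun k j => towerBondsP θ.L a.toZdIdx.Ω (a.toZdIdx.Λs k) j) ops₀) aT B₀N M a.toZdIdx m)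
    (hhol : ∀ (a : IdxB8SubDPerκ θ (Mκ * θ.L) Mκ Rκ) (m : ℕ), m ≤ a.toZdIdx.k →
      HolderAtIH2Per (Mκ * θ.L) θ.L (opsAllZdPer τ θ.L (Mκ * θ.L) (fun k j => towerBondsP θ.L a.toZdIdx.Ω (a.toZdIdx.Λs k) j) ops₀) aT Cβ β len M a.toZdIdx m)
    (hsrc : ∀ (a : IdxB8SubDPerκ θ (Mκ * θ.L) Mκ Rκ) (m : ℕ), m ≤ a.toZdIdx.k →
      SrcAtIPer (Mκ * θ.L) θ.L (opsAllZdPer τ θ.L (Mκ * θ.L) (fun k j => towerBondsP θ.L a.toZdIdx.Ω (a.toZdIdx.Λs k) j) ops₀) aS cS M a.toZdIdx m)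
    (hsrcH : ∀ (a : IdxB8SubDPerκ θ (Mκ * θ.L) Mκ Rκ) (m : ℕ), m ≤ a.toZdIdx.k →
      SrcHolderAtIH2Per (Mκ * θ.L) θ.L (opsAllZdPer τ θ.L (Mκ * θ.L) (fun k j => towerBondsP θ.L a.toZdIdx.Ω (a.toZdIdx.Λs k) j) ops₀) aS cSβ β len M a.toZdIdx m)
    -- [4]'s LETTERS AT PERIODIC ARGUMENTS — HYPOTHESES (NODE N06's periodic letters ∕ lit-balaban to serve; [Balaban1985BackgroundPropagators] Thm 3.1 p. 397, Thms 3.2–3.3):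
    -- (E) the EXISTENCE letters at every print-class periodic member, every unitary `P`-periodic background in the SMALL-FIELD class `𝔄_k({Ω_j}, α₀)`,
    -- `0 < α₀ ≤ c_L` ([4] Thm 3.1's regime), every truncation `1 ≤ n ≤ k` — `B8Prop5NestedServerSrcPerL`'s thresholded `hLet` text VERBATIM (= dag-n05-c's
    -- `…P5FrameSocketsServedL` displayed input; the currency-2 existence letters `SLet` are its truncation-`k` instance);
    -- (U) the UNIQUENESS letters at the periodic members of record `a : IdxB8LanCκPer θ P Mκ Rκ` — `B8Prop5UniqueZdLanPer`'s `SLetUBper` VERBATIM (as in (13)′β∕δ)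
    (hLet : ∀ a : IdxB8SubDPerκ θ (Mκ * θ.L) Mκ Rκ, ∀ α₀ : ℝ, 0 < α₀ → α₀ ≤ cL → ∀ U₀ : Site θ.D → Fin θ.D → θ.𝔸ˣ, (∀ x κ, U₀ x κ ∈ unitaryUnits θ.𝔸) → IsPeriodic (Mκ * θ.L) U₀ →
      InAk θ.L a.toZdIdx.k a.toZdIdx.η α₀ a.toZdIdx.Ω U₀ → ∀ n, 1 ≤ n → n ≤ a.toZdIdx.k →
      ∃ (g Δ : (Site θ.D → θ.𝔸) →ₗ[ℂ] (Site θ.D → θ.𝔸)) (q : (Site θ.D → θ.𝔸) →ₗ[ℂ] (ℕ → Site θ.D → θ.𝔸)) (qs : (ℕ → Site θ.D → θ.𝔸) →ₗ[ℂ] (Site θ.D → θ.𝔸))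
        (Aw c : (ℕ → Site θ.D → θ.𝔸) →ₗ[ℂ] (ℕ → Site θ.D → θ.𝔸)) (H' : XSpace θ.D n θ.𝔸 →ₗ[ℂ] (Site θ.D → θ.𝔸)),
        (∀ x, (∀ (z : Site θ.D) (i : Fin θ.D), x (z + ((Mκ * θ.L) : ℤ) • e i) = x z) → ∀ y ∈ a.toZdIdx.Ω 0, (Δ (g x) + qs (Aw (q (g x)))) y = x y) ∧
        (∀ f, (∀ (z : Site θ.D) (i : Fin θ.D), f (z + ((Mκ * θ.L) : ℤ) • e i) = f z) → q (g (g (qs (c (q f))))) = q f) ∧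
        (∀ (f : Site θ.D → θ.𝔸) (z : Site θ.D) (i : Fin θ.D), g f (z + ((Mκ * θ.L) : ℤ) • e i) = g f z) ∧
        (∀ f : Site θ.D → θ.𝔸, (∀ (z : Site θ.D) (i : Fin θ.D), f (z + ((Mκ * θ.L) : ℤ) • e i) = f z) →
      ∀ (z : Site θ.D) (i : Fin θ.D), qs (c (q f)) (z + ((Mκ * θ.L) : ℤ) • e i) = qs (c (q f)) z) ∧
        (∀ (f : Site θ.D → θ.𝔸), ∀ x ∈ a.toZdIdx.Ω 0, Δ f x = covLap a.toZdIdx.η U₀ ((a.toZdIdx.Ω 0).indicator f) x) ∧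
        (∀ (μ : ℕ → Site θ.D → θ.𝔸), ∀ x ∈ a.toZdIdx.Ω 0, qs μ x = QT θ.L n (a.toZdIdx.Λs n) U₀ μ x) ∧
        (∀ (f : Site θ.D → θ.𝔸) (j : ℕ), j ≤ n → ∀ y ∈ a.toZdIdx.Λs n j, q f j y = QprimeIter (zdBlocking θ.D θ.L) (bgT θ.L U₀) j f y) ∧
        (∀ (X : XSpace θ.D n θ.𝔸) (x : Site θ.D), ‖H' X x‖ ≤ B₀'H * ‖X‖) ∧
        (∀ j, j ≤ n → ∀ (X : XSpace θ.D n θ.𝔸), ∀ b ∈ {b : Site θ.D × Fin θ.D | SideTouches (a.toZdIdx.Ω j) b.1 b.2},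
      wt θ.L a.toZdIdx.η j * ‖covDerivFwd a.toZdIdx.η U₀ b.2 (H' X) b.1‖ ≤ B₀'H * ‖X‖) ∧
        (∀ X : XSpace θ.D n θ.𝔸, Bd2 θ.L a.toZdIdx.η n a.toZdIdx.Ω (covLap a.toZdIdx.η U₀ (H' X)) (B₂' * ‖X‖)) ∧
        (∀ (X : XSpace θ.D n θ.𝔸) (x : Site θ.D), x ∉ a.toZdIdx.Ω 0 → H' X x = 0) ∧
        (∀ X Y : XSpace θ.D n θ.𝔸, (∀ b, Y b = -star (X b)) → ∀ x, H' Y x = -star (H' X x)) ∧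
        (∀ X : XSpace θ.D n θ.𝔸, (∀ (b : Fin (n + 1) × Site θ.D) (i : Fin θ.D), X (b.1, b.2 + (((Mκ * θ.L) : ℤ) / (θ.L : ℤ) ^ (b.1 : ℕ)) • e i) = X b) →
      ∀ (z : Site θ.D) (i : Fin θ.D), H' X (z + ((Mκ * θ.L) : ℤ) • e i) = H' X z) ∧
        (∀ (Y : XSpace θ.D n θ.𝔸), (∀ (b : Fin (n + 1) × Site θ.D) (i : Fin θ.D), Y (b.1, b.2 + (((Mκ * θ.L) : ℤ) / (θ.L : ℤ) ^ (b.1 : ℕ)) • e i) = Y b) →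
      ∀ (j : ℕ) (hj : j ≤ n) (y : Site θ.D), y ∈ a.toZdIdx.Λs n j →
      QprimeIter (zdBlocking θ.D θ.L) (bgT θ.L U₀) j (H' Y) y = Y (⟨j, Nat.lt_succ_of_le hj⟩, y)) ∧
        (∀ (f : Site θ.D → θ.𝔸) (r : ℝ), 0 ≤ r → Bd2 θ.L a.toZdIdx.η n a.toZdIdx.Ω f r →
      (∀ x, ‖g f x‖ ≤ BG * r) ∧ ∀ j, j ≤ n → ∀ b ∈ {b : Site θ.D × Fin θ.D | SideTouches (a.toZdIdx.Ω j) b.1 b.2},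
        wt θ.L a.toZdIdx.η j * ‖covDerivFwd a.toZdIdx.η U₀ b.2 (g f) b.1‖ ≤ BG * r) ∧
        (∀ (f : Site θ.D → θ.𝔸) (x : Site θ.D), x ∉ a.toZdIdx.Ω 0 → g f x = 0) ∧
        (∀ f : Site θ.D → θ.𝔸, (∀ j, j ≤ n → ∀ x ∈ a.toZdIdx.Ω j, IsSelfAdjoint (f x)) → ∀ x, IsSelfAdjoint (g f x)) ∧
        (∀ (f : Site θ.D → θ.𝔸) (r : ℝ), 0 ≤ r → Bd2 θ.L a.toZdIdx.η n a.toZdIdx.Ω f r → Bd2 θ.L a.toZdIdx.η n a.toZdIdx.Ω (f - g (qs (c (q (g f))))) (BR * r)) ∧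
        (∀ f : Site θ.D → θ.𝔸, (∀ j, j ≤ n → ∀ x ∈ a.toZdIdx.Ω j, IsSelfAdjoint (f x)) →
      ∀ j, j ≤ n → ∀ x ∈ a.toZdIdx.Ω j, IsSelfAdjoint ((f - g (qs (c (q (g f))))) x)))
    (SLetUB : ∀ a : IdxB8LanCκPer θ (Mκ * θ.L) Mκ Rκ, ∀ α₀ : ℝ, 0 < α₀ → α₀ ≤ cL → InAk θ.L a.toZdLanIdx.k a.toZdLanIdx.η α₀ a.toZdLanIdx.Ω a.toZdLanIdx.U₀ →
      ∃ (g Δ : (Site θ.D → θ.𝔸) →ₗ[ℂ] (Site θ.D → θ.𝔸)) (q : (Site θ.D → θ.𝔸) →ₗ[ℂ] (ℕ → Site θ.D → θ.𝔸)) (qs : (ℕ → Site θ.D → θ.𝔸) →ₗ[ℂ] (Site θ.D → θ.𝔸))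
        (Aw c : (ℕ → Site θ.D → θ.𝔸) →ₗ[ℂ] (ℕ → Site θ.D → θ.𝔸)) (H' : XSpace θ.D a.toZdLanIdx.k θ.𝔸 →ₗ[ℂ] (Site θ.D → θ.𝔸)),
        (∀ x : Site θ.D → θ.𝔸, (∀ (z : Site θ.D) (i : Fin θ.D), x (z + ((Mκ * θ.L) : ℤ) • e i) = x z) → (∃ C : ℝ, ∀ y, ‖x y‖ ≤ C) →
          g (Δ x + qs (Aw (q x))) = x) ∧
        (∀ φ : ℕ → Site θ.D → θ.𝔸, (∀ n, n ≤ a.toZdLanIdx.k → ∀ (y : Site θ.D) (i : Fin θ.D), φ n (y + (((Mκ * θ.L) : ℤ) / (θ.L : ℤ) ^ n) • e i) = φ n y) →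
          qs (c (q (g (g (qs φ))))) = qs φ) ∧
        (∀ (f : Site θ.D → θ.𝔸), ∀ x ∈ a.toZdLanIdx.Ω 0, Δ f x = covLap a.toZdLanIdx.η a.toZdLanIdx.U₀ ((a.toZdLanIdx.Ω 0).indicator f) x) ∧
        (∀ (μ : ℕ → Site θ.D → θ.𝔸), ∀ x ∈ a.toZdLanIdx.Ω 0, qs μ x = QT θ.L a.toZdLanIdx.k a.toZdLanIdx.Λ a.toZdLanIdx.U₀ μ x) ∧
        (∀ (f : Site θ.D → θ.𝔸) (n : ℕ), n ≤ a.toZdLanIdx.k → ∀ y ∈ a.toZdLanIdx.Λ n, q f n y = QprimeIter (zdBlocking θ.D θ.L) (bgT θ.L a.toZdLanIdx.U₀) n f y) ∧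
        (∀ (f : Site θ.D → θ.𝔸) (n : ℕ) (y : Site θ.D), ¬ (n ≤ a.toZdLanIdx.k ∧ y ∈ a.toZdLanIdx.Λ n) → q f n y = 0) ∧
        (∀ (f : Site θ.D → θ.𝔸) (z : Site θ.D) (i : Fin θ.D), g f (z + ((Mκ * θ.L) : ℤ) • e i) = g f z) ∧
        (∀ μ : ℕ → Site θ.D → θ.𝔸, ∀ n, n ≤ a.toZdLanIdx.k → ∀ (y : Site θ.D) (i : Fin θ.D), Aw μ n (y + (((Mκ * θ.L) : ℤ) / (θ.L : ℤ) ^ n) • e i) = Aw μ n y) ∧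
        (∀ (X : XSpace θ.D a.toZdLanIdx.k θ.𝔸) (x : Site θ.D), ‖H' X x‖ ≤ B₀'H * ‖X‖) ∧
        (∀ n, n ≤ a.toZdLanIdx.k → ∀ (X : XSpace θ.D a.toZdLanIdx.k θ.𝔸), ∀ b ∈ {b : Site θ.D × Fin θ.D | SideTouches (a.toZdLanIdx.Ω n) b.1 b.2},
          wt θ.L a.toZdLanIdx.η n * ‖covDerivFwd a.toZdLanIdx.η a.toZdLanIdx.U₀ b.2 (H' X) b.1‖ ≤ B₀'H * ‖X‖) ∧
        (∀ X : XSpace θ.D a.toZdLanIdx.k θ.𝔸, Bd2 θ.L a.toZdLanIdx.η a.toZdLanIdx.k a.toZdLanIdx.Ω (covLap a.toZdLanIdx.η a.toZdLanIdx.U₀ (H' X)) (B₂' * ‖X‖)) ∧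
        (∀ X : XSpace θ.D a.toZdLanIdx.k θ.𝔸, (∀ (q : Fin (a.toZdLanIdx.k + 1) × Site θ.D) (i : Fin θ.D), X (q.1, q.2 + (((Mκ * θ.L) : ℤ) / (θ.L : ℤ) ^ (q.1 : ℕ)) • e i) = X q) →
          ∀ (z : Site θ.D) (i : Fin θ.D), H' X (z + ((Mκ * θ.L) : ℤ) • e i) = H' X z) ∧
        (∀ (Y : XSpace θ.D a.toZdLanIdx.k θ.𝔸), (∀ (q : Fin (a.toZdLanIdx.k + 1) × Site θ.D) (i : Fin θ.D), Y (q.1, q.2 + (((Mκ * θ.L) : ℤ) / (θ.L : ℤ) ^ (q.1 : ℕ)) • e i) = Y q) →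
          ∀ (n : ℕ) (hn : n ≤ a.toZdLanIdx.k) (y : Site θ.D), y ∈ a.toZdLanIdx.Λ n →
          QprimeIter (zdBlocking θ.D θ.L) (bgT θ.L a.toZdLanIdx.U₀) n (H' Y) y = Y (⟨n, Nat.lt_succ_of_le hn⟩, y)) ∧
        (∀ (f : Site θ.D → θ.𝔸) (r : ℝ), 0 ≤ r → Bd2 θ.L a.toZdLanIdx.η a.toZdLanIdx.k a.toZdLanIdx.Ω f r →
          (∀ x, ‖g f x‖ ≤ BG * r) ∧ ∀ n, n ≤ a.toZdLanIdx.k → ∀ b ∈ {b : Site θ.D × Fin θ.D | SideTouches (a.toZdLanIdx.Ω n) b.1 b.2},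
            wt θ.L a.toZdLanIdx.η n * ‖covDerivFwd a.toZdLanIdx.η a.toZdLanIdx.U₀ b.2 (g f) b.1‖ ≤ BG * r) ∧
        (∀ (f : Site θ.D → θ.𝔸) (r : ℝ), 0 ≤ r → Bd2 θ.L a.toZdLanIdx.η a.toZdLanIdx.k a.toZdLanIdx.Ω f r →
          Bd2 θ.L a.toZdLanIdx.η a.toZdLanIdx.k a.toZdLanIdx.Ω (f - g (qs (c (q (g f))))) (BR * r))) :
    ∃ (lam8 : ResidB8 θ) (P : ℕ) (c₁ : ℝ) (ρ₀' : ℕ)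
      (ax : ∀ j : IdxB8SubDPer θ P, (famB8OfRecordPer θ (lam8.cutSubBP₅κPer P Mκ Rκ c₁ ρ₀').β (lam8.cutSubBP₅κPer P Mκ Rκ c₁ ρ₀').len P j).Cfg →
        (famB8OfRecordPer θ (lam8.cutSubBP₅κPer P Mκ Rκ c₁ ρ₀').β (lam8.cutSubBP₅κPer P Mκ Rκ c₁ ρ₀').len P j).Pert →
        (famB8OfRecordPer θ (lam8.cutSubBP₅κPer P Mκ Rκ c₁ ρ₀').β (lam8.cutSubBP₅κPer P Mκ Rκ c₁ ρ₀').len P j).Pert),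
      (0 < P ∧ Mκ * θ.L ∣ P) ∧ 0 < c₁ ∧ 1 ≤ ρ₀' ∧ B8LeafOfRecordSubBP₂DPerκ θ P Mκ Rκ ⟨lam8.cutSubBP₅κPer P Mκ Rκ c₁ ρ₀', ax⟩ := by
  obtain ⟨lam, c₁, ρ₀', ax, hc₁, hρ₀', h⟩ := exists_residB8_slot8κ'_of_bindersLettersPer_doorL_at θ hD hL5 Mκ Rκ (Mκ * θ.L) τ hτp hτt hτs hCτ ops₀ hM1 haI haT haS hB₀N hCβ hcS hcSβ hB₀'H hB₂' hBG hBR hcL hinv hglob hhol hsrc hsrcH hLet SLetUB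
  have hL1 : 1 ≤ θ.L := le_trans one_le_two θ.two_le_L
  exact ⟨lam, Mκ * θ.L, c₁, ρ₀', ax, ⟨Nat.mul_pos (Nat.lt_of_lt_of_le Nat.zero_lt_one hM₁) (Nat.lt_of_lt_of_le Nat.zero_lt_one hL1), dvd_rfl⟩, hc₁, hρ₀', h⟩

end Door

end Summit.QuantumFields.YangMills.BalabanUVNodes.N05SubBP2DK2PerKappaSlotExistsOfBindersLettersPerDoorL

end
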